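import Summits.RiemannHypothesis.RiemannHypothesis.Theorems.GroundBartaPolarPerronFrobeniusEvenGainFubini
import Summits.RiemannHypothesis.RiemannHypothesis.Theorems.GroundBartaGroundBartaFloorDefs
import HarnessLib

/-!
# RiemannHypothesis / GroundBarta — crux `PolarPerronFrobenius` (stmt-RiemannHypothesis-18390):
# the source criterion, part S1: the `f⁺ ⊗ f⁻` bound across a zero and the UNTRUNCATED kernel

Helper file (`--supports stmt-RiemannHypothesis-18390`), RH-free, Mathlib + proved tree files only,
no definitions, no named facts.

Parts E1–E3 (even-sector sign improvement) used the archimedean jump kernel TRUNCATED at height `5`,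
`min(w(|x−y|), 5)`, which suffices for a pointwise kernel comparison but kills the capacity term
`∫_{bulk} u(x) w(|x−y|) dx ≈ ½Φ(a) log(1/ζ)` that the harmonic-majorant line needs at large windows.
The untruncated kernel `w(|x−y|) ~ 1/(2|x−y|)` is not locally integrable on the diagonal, but it only
ever meets the product `f⁺(x) f⁻(y)`, and between a point where `f > 0` and a point where `f < 0`
there is a zero of `f`, so that

  `f⁺(x) f⁻(y) ≤ L² |x − y|²`   (`L` a Lipschitz constant of `f`; `swu_posPart_mul_negPart_le`).

Hence `w(|x−y|) f⁺(x) f⁻(y) ≤ L² |x−y|² w(|x−y|) ≤ L² a e^{a}` on `[-a,a]²` (`swu_kernelProd_le`): the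
untruncated bilinear integrands are bounded and compactly supported, and all the Fubini /
translation / reflection identities of part E2b hold with `w(|·|)` in place of `min(w(|·|),5)`:
`swu_gain_fubini`, `swu_integrable_marginal` (this file), `swu_inner_eq`, `swu_inner_even` (part S2).

Prover B, speedrun unit `sr-gb-rung-b` (seat 2).
-/

set_option linter.dupNamespace false

noncomputable section

open Set MeasureTheory Filter Complex
open scoped Real Topology

namespace Summit.RiemannHypothesis.RiemannHypothesis.Theorems.PolarPerronFrobenius

open Literature.NumberTheory.LFunctions

/-! ## A Lipschitz constant and the bound across a zero -/

section Zero

variable {f : ℝ → ℝ}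

/-- A smooth compactly supported real function is Lipschitz: `|f x − f y| ≤ L |x − y|` with
`L = sup |f'|`. [folklore] -/
theorem swu_exists_lipschitz (hf : ContDiff ℝ (⊤ : ℕ∞) f) (hfs : HasCompactSupport f) :
    ∃ L : ℝ, 0 ≤ L ∧ ∀ x y, |f x - f y| ≤ L * |x - y| := by
  have hd : Continuous (deriv f) := hf.continuous_deriv (by simp)
  obtain ⟨L, hL0, hL⟩ := swe_exists_bound hd hfs.deriv
  refine ⟨L, hL0, fun x y ↦ ?_⟩
  have hdiff : ∀ z ∈ (Set.univ : Set ℝ), DifferentiableAt ℝ f z := fun z _ ↦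
    (hf.differentiable (by simp)).differentiableAt
  have h := Convex.norm_image_sub_le_of_norm_deriv_le (𝕜 := ℝ) hdiff
    (fun z _ ↦ by rw [Real.norm_eq_abs]; exact hL z) convex_univ (Set.mem_univ y) (Set.mem_univ x)
  rwa [Real.norm_eq_abs, Real.norm_eq_abs] at h

/-- **The bound across a zero**: if `|f x − f y| ≤ L|x − y|` for all `x, y` and `f` is continuous, then
`f⁺(x) f⁻(y) ≤ L² (x − y)²` — between a point with `f > 0` and a point with `f < 0` lies a zero `z` of
`f`, and `f⁺(x) = |f x − f z| ≤ L|x − z| ≤ L|x − y|`, `f⁻(y) = |f z − f y| ≤ L|x − y|`. [folklore] -/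
theorem swu_posPart_mul_negPart_le (hfc : Continuous f) {L : ℝ} (hL0 : 0 ≤ L)
    (hL : ∀ x y, |f x - f y| ≤ L * |x - y|) (x y : ℝ) :
    max (f x) 0 * max (-f y) 0 ≤ L ^ 2 * (x - y) ^ 2 := by
  by_cases hx : f x ≤ 0
  · rw [max_eq_right hx, zero_mul]; positivity
  by_cases hy : 0 ≤ f y
  · rw [max_eq_right (neg_nonpos.2 hy), mul_zero]; positivity
  have hx : 0 < f x := lt_of_not_ge hx
  have hy : f y < 0 := lt_of_not_ge hy
  -- a zero between `x` and `y`
  have h0 : (0 : ℝ) ∈ Set.uIcc (f x) (f y) := by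
    rw [Set.mem_uIcc]; exact Or.inr ⟨hy.le, hx.le⟩
  obtain ⟨z, hz, hfz⟩ := intermediate_value_uIcc hfc.continuousOn h0
  have h1 : |x - z| ≤ |x - y| := by
    have := Set.abs_sub_left_of_mem_uIcc hz
    rw [abs_sub_comm] at this; rwa [abs_sub_comm x y]
  have h2 : |z - y| ≤ |x - y| := by
    have := Set.abs_sub_right_of_mem_uIcc hz
    rw [abs_sub_comm y z, abs_sub_comm y x] at this; exact this
  have hpx : max (f x) 0 ≤ L * |x - y| := by
    rw [max_eq_left hx.le]
    calc f x = |f x - f z| := by rw [hfz, sub_zero, abs_of_pos hx]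
      _ ≤ L * |x - z| := hL x z
      _ ≤ L * |x - y| := mul_le_mul_of_nonneg_left h1 hL0
  have hny : max (-f y) 0 ≤ L * |x - y| := by
    rw [max_eq_left (by linarith)]
    calc -f y = |f z - f y| := by rw [hfz, zero_sub, abs_neg, abs_of_neg hy]
      _ ≤ L * |z - y| := hL z y
      _ ≤ L * |x - y| := mul_le_mul_of_nonneg_left h2 hL0
  calc max (f x) 0 * max (-f y) 0 ≤ (L * |x - y|) * (L * |x - y|) :=
        mul_le_mul hpx hny (le_max_right _ _) (by positivity)
    _ = L ^ 2 * (x - y) ^ 2 := by rw [← sq_abs (x - y)]; ring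

/-- `s² w(s) ≤ s e^{s/2} / 2` for `s > 0` (`w(s) ≤ e^{s/2}/(2s)`), hence `≤ a e^{a}` for `0 < s ≤ 2a`.
[folklore] -/
theorem swu_sq_mul_weilArchDensity_le {s a : ℝ} (hs : 0 < s) (hsa : s ≤ 2 * a) :
    s ^ 2 * weilArchDensity s ≤ a * Real.exp a := by
  have h := weilArchDensity_le_exp_half_div hs
  have ha : 0 < a := by linarith
  have h1 : s ^ 2 * weilArchDensity s ≤ s * Real.exp (s / 2) / 2 := by
    calc s ^ 2 * weilArchDensity s ≤ s ^ 2 * (Real.exp (s / 2) / (2 * s)) :=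
          mul_le_mul_of_nonneg_left h (by positivity)
      _ = s * Real.exp (s / 2) / 2 := by field_simp
  have h2 : Real.exp (s / 2) ≤ Real.exp a := Real.exp_le_exp.2 (by linarith)
  have h3 : s * Real.exp (s / 2) / 2 ≤ a * Real.exp a := by
    have := Real.exp_pos (s / 2)
    nlinarith
  linarith

/-- **The untruncated kernel against `f⁺ ⊗ f⁻` is bounded**: for `f` continuous with Lipschitz
constant `L`, supported in `[-a, a]` (`a > 0`),
`w(|x − y|) f⁺(x) f⁻(y) ≤ L² a e^{a}` everywhere. [folklore] -/
theorem swu_kernelProd_le (hfc : Continuous f) {L a : ℝ} (hL0 : 0 ≤ L)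
    (hL : ∀ x y, |f x - f y| ≤ L * |x - y|) (ha : 0 < a) (hsupp : Function.support f ⊆ Icc (-a) a)
    (x y : ℝ) :
    weilArchDensity |x - y| * (max (f x) 0 * max (-f y) 0) ≤ L ^ 2 * (a * Real.exp a) := by
  have hR : 0 ≤ L ^ 2 * (a * Real.exp a) := by positivity
  by_cases hx : f x ≤ 0
  · rw [max_eq_right hx, zero_mul, mul_zero]; exact hR
  by_cases hy : 0 ≤ f y
  · rw [max_eq_right (neg_nonpos.2 hy), mul_zero, mul_zero]; exact hR
  have hx : 0 < f x := lt_of_not_ge hx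
  have hy : f y < 0 := lt_of_not_ge hy
  have hxs : x ∈ Icc (-a) a := hsupp (Function.mem_support.2 hx.ne')
  have hys : y ∈ Icc (-a) a := hsupp (Function.mem_support.2 hy.ne)
  have hxy : x ≠ y := fun h ↦ by rw [h] at hx; linarith
  have hs : 0 < |x - y| := abs_pos.2 (sub_ne_zero.2 hxy)
  have hs2 : |x - y| ≤ 2 * a := by
    rw [abs_le]; constructor <;> linarith [hxs.1, hxs.2, hys.1, hys.2]
  have h1 := swu_posPart_mul_negPart_le hfc hL0 hL x y
  have h2 := swu_sq_mul_weilArchDensity_le hs hs2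
  have hw0 := (weilArchDensity_pos hs).le
  rw [sq_abs] at h2
  calc weilArchDensity |x - y| * (max (f x) 0 * max (-f y) 0)
      ≤ weilArchDensity |x - y| * (L ^ 2 * (x - y) ^ 2) := mul_le_mul_of_nonneg_left h1 hw0
    _ = L ^ 2 * ((x - y) ^ 2 * weilArchDensity |x - y|) := by ring
    _ ≤ L ^ 2 * (a * Real.exp a) := mul_le_mul_of_nonneg_left h2 (sq_nonneg _)

end Zero

/-! ## Fubini for the untruncated gain -/

section Fubini

variable {f : ℝ → ℝ} {a : ℝ}

/-- `t ↦ w(|t|)` is measurable. [folklore] -/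
theorem swu_measurable_kernel : Measurable fun t : ℝ ↦ weilArchDensity |t| :=
  measurable_weilArchDensity.comp measurable_abs

/-- **Fubini for the untruncated gain.**  For a smooth compactly supported real `f` with
`supp f ⊆ [-a, a]`:
`∫ w(|t|)·(4∫ f⁻(x)(f⁺(x+t) + f⁺(x−t)) dx) dt = 4∫ f⁻(x)·(∫ w(|t|)(f⁺(x+t) + f⁺(x−t)) dt) dx`
(the integrand on `ℝ²` is bounded by `2L²ae^{a}` and supported in `[-a,a] × [-2a,2a]`). [folklore] -/
theorem swu_gain_fubini (hf : ContDiff ℝ (⊤ : ℕ∞) f) (hfs : HasCompactSupport f) (ha : 0 < a)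
    (hsupp : Function.support f ⊆ Icc (-a) a) :
    ∫ t, weilArchDensity |t| * (4 * ∫ x, max (-f x) 0 * (max (f (x + t)) 0 + max (f (x - t)) 0)) =
      4 * ∫ x, max (-f x) 0 *
        ∫ t, weilArchDensity |t| * (max (f (x + t)) 0 + max (f (x - t)) 0) := by
  have hfc : Continuous f := hf.continuous
  have hp : Continuous fun x ↦ max (f x) 0 := hfc.max continuous_const
  have hn : Continuous fun x ↦ max (-f x) 0 := hfc.neg.max continuous_const
  obtain ⟨L, hL0, hL⟩ := swu_exists_lipschitz hf hfs
  set C : ℝ := L ^ 2 * (a * Real.exp a) with hC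
  -- the integrand on `ℝ × ℝ`, variables `(t, x)`
  set Φ : ℝ → ℝ → ℝ := fun t x ↦
    weilArchDensity |t| * (max (-f x) 0 * (max (f (x + t)) 0 + max (f (x - t)) 0)) with hΦ
  have hmeas : AEStronglyMeasurable (Function.uncurry Φ) (volume.prod volume) := by
    refine Measurable.aestronglyMeasurable ?_
    have m1 : Measurable fun q : ℝ × ℝ ↦ weilArchDensity |q.1| := swu_measurable_kernel.comp measurable_fst
    have m2 : Measurable fun q : ℝ × ℝ ↦ max (-f q.2) 0 := hn.measurable.comp measurable_snd
    have m3 : Measurable fun q : ℝ × ℝ ↦ max (f (q.2 + q.1)) 0 :=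
      hp.measurable.comp (measurable_snd.add measurable_fst)
    have m4 : Measurable fun q : ℝ × ℝ ↦ max (f (q.2 - q.1)) 0 :=
      hp.measurable.comp (measurable_snd.sub measurable_fst)
    exact m1.mul (m2.mul (m3.add m4))
  -- domination by `2C · 𝟙_{[-2a,2a]}(t) 𝟙_{[-a,a]}(x)`
  have hdom : Integrable (fun q : ℝ × ℝ ↦
      (Set.indicator (Icc (-(2 * a)) (2 * a)) (fun _ ↦ (2 * C : ℝ)) q.1) *
        (Set.indicator (Icc (-a) a) (fun _ ↦ (1 : ℝ)) q.2)) (volume.prod volume) := by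
    refine Integrable.mul_prod ?_ ?_
    · exact (integrable_indicator_iff measurableSet_Icc).2 (integrableOn_const (by simp))
    · exact (integrable_indicator_iff measurableSet_Icc).2 (integrableOn_const (by simp))
  have hint : Integrable (Function.uncurry Φ) (volume.prod volume) := by
    refine hdom.mono' hmeas (Eventually.of_forall fun q ↦ ?_)
    obtain ⟨t, x⟩ := q
    simp only [Function.uncurry, hΦ]
    have hk0 := GroundBartaFloor.weilArchDensity_abs_nonneg t
    have hn0 : 0 ≤ max (-f x) 0 := le_max_right _ _
    have hp1' : 0 ≤ max (f (x + t)) 0 := le_max_right _ _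
    have hp2' : 0 ≤ max (f (x - t)) 0 := le_max_right _ _
    rw [Real.norm_of_nonneg (mul_nonneg hk0 (mul_nonneg hn0 (add_nonneg hp1' hp2')))]
    -- the two pieces are bounded by `C` each (kernel against `f⁺ ⊗ f⁻` across a zero)
    have b1 : weilArchDensity |t| * (max (f (x + t)) 0 * max (-f x) 0) ≤ C := by
      have h := swu_kernelProd_le hfc hL0 hL ha hsupp (x + t) x
      rwa [show x + t - x = t by ring] at h
    have b2 : weilArchDensity |t| * (max (f (x - t)) 0 * max (-f x) 0) ≤ C := by
      have h := swu_kernelProd_le hfc hL0 hL ha hsupp (x - t) x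
      rwa [show x - t - x = -t by ring, abs_neg] at h
    by_cases hx : x ∈ Icc (-a) a
    · by_cases ht : t ∈ Icc (-(2 * a)) (2 * a)
      · rw [Set.indicator_of_mem ht, Set.indicator_of_mem hx, mul_one]
        nlinarith
      · -- `|t| > 2a`: both `f⁺(x ± t)` vanish
        have hz : max (f (x + t)) 0 = 0 ∧ max (f (x - t)) 0 = 0 := by
          rw [Set.mem_Icc, not_and_or, not_le, not_le] at ht
          constructor
          · have : f (x + t) = 0 := by
              by_contra hne
              have hm := hsupp (Function.mem_support.2 hne)
              rcases ht with ht | ht <;> linarith [hm.1, hm.2, hx.1, hx.2]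
            rw [this, max_self]
          · have : f (x - t) = 0 := by
              by_contra hne
              have hm := hsupp (Function.mem_support.2 hne)
              rcases ht with ht | ht <;> linarith [hm.1, hm.2, hx.1, hx.2]
            rw [this, max_self]
        rw [hz.1, hz.2, add_zero, mul_zero, mul_zero]
        exact mul_nonneg (Set.indicator_nonneg (fun _ _ ↦ by positivity) _)
          (Set.indicator_nonneg (fun _ _ ↦ zero_le_one) _)
    · have hfx : f x = 0 := by
        by_contra hne; exact hx (hsupp (Function.mem_support.2 hne))
      rw [hfx, neg_zero, max_self, zero_mul, mul_zero]
      exact mul_nonneg (Set.indicator_nonneg (fun _ _ ↦ by positivity) _)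
        (Set.indicator_nonneg (fun _ _ ↦ zero_le_one) _)
  have hswap := integral_integral_swap hint
  have hL' : ∫ t, weilArchDensity |t| *
      (4 * ∫ x, max (-f x) 0 * (max (f (x + t)) 0 + max (f (x - t)) 0)) = 4 * ∫ t, ∫ x, Φ t x := by
    rw [← integral_const_mul (4 : ℝ) (fun t ↦ ∫ x, Φ t x)]
    refine integral_congr_ae (Eventually.of_forall fun t ↦ ?_)
    simp only [hΦ]
    rw [integral_const_mul (weilArchDensity |t|)]
    ring
  have hR : ∫ x, max (-f x) 0 * ∫ t, weilArchDensity |t| * (max (f (x + t)) 0 + max (f (x - t)) 0) =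
      ∫ x, ∫ t, Φ t x := by
    refine integral_congr_ae (Eventually.of_forall fun x ↦ ?_)
    simp only [hΦ]
    rw [← integral_const_mul (max (-f x) 0)]
    refine integral_congr_ae (Eventually.of_forall fun t ↦ ?_)
    simp only
    ring
  rw [hL', hR, hswap]

/-- The `x`-marginal `x ↦ f⁻(x) ∫ w(|t|)(f⁺(x+t)+f⁺(x−t)) dt` is integrable. [folklore] -/
theorem swu_integrable_marginal (hf : ContDiff ℝ (⊤ : ℕ∞) f) (hfs : HasCompactSupport f) (ha : 0 < a)
    (hsupp : Function.support f ⊆ Icc (-a) a) :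
    Integrable fun x ↦ max (-f x) 0 *
      ∫ t, weilArchDensity |t| * (max (f (x + t)) 0 + max (f (x - t)) 0) := by
  have hfc : Continuous f := hf.continuous
  have hp : Continuous fun x ↦ max (f x) 0 := hfc.max continuous_const
  have hn : Continuous fun x ↦ max (-f x) 0 := hfc.neg.max continuous_const
  have hns := swe_hasCompactSupport_negPart hfs
  obtain ⟨L, hL0, hL⟩ := swu_exists_lipschitz hf hfs
  set C : ℝ := L ^ 2 * (a * Real.exp a) with hC
  -- pointwise: `f⁻(x) · (integrand) ≤ 2C 𝟙_{[-2a,2a]}(t)`, so the product is bounded by `2C · 4a`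
  have hbd : ∀ x, ‖max (-f x) 0 *
      ∫ t, weilArchDensity |t| * (max (f (x + t)) 0 + max (f (x - t)) 0)‖ ≤
      Set.indicator (Icc (-a) a) (fun _ ↦ 2 * C * (4 * a)) x := by
    intro x
    by_cases hx : x ∈ Icc (-a) a
    · rw [Set.indicator_of_mem hx, Real.norm_eq_abs, ← integral_const_mul, abs_le]
      have hI : ∀ t, |max (-f x) 0 * (weilArchDensity |t| * (max (f (x + t)) 0 + max (f (x - t)) 0))| ≤
          Set.indicator (Icc (-(2 * a)) (2 * a)) (fun _ ↦ 2 * C) t := by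
        intro t
        have hk0 := GroundBartaFloor.weilArchDensity_abs_nonneg t
        have hn0 : 0 ≤ max (-f x) 0 := le_max_right _ _
        have hp1' : 0 ≤ max (f (x + t)) 0 := le_max_right _ _
        have hp2' : 0 ≤ max (f (x - t)) 0 := le_max_right _ _
        rw [abs_of_nonneg (mul_nonneg hn0 (mul_nonneg hk0 (add_nonneg hp1' hp2')))]
        have b1 : weilArchDensity |t| * (max (f (x + t)) 0 * max (-f x) 0) ≤ C := by
          have h := swu_kernelProd_le hfc hL0 hL ha hsupp (x + t) x
          rwa [show x + t - x = t by ring] at h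
        have b2 : weilArchDensity |t| * (max (f (x - t)) 0 * max (-f x) 0) ≤ C := by
          have h := swu_kernelProd_le hfc hL0 hL ha hsupp (x - t) x
          rwa [show x - t - x = -t by ring, abs_neg] at h
        by_cases ht : t ∈ Icc (-(2 * a)) (2 * a)
        · rw [Set.indicator_of_mem ht]; nlinarith
        · have hz : max (f (x + t)) 0 = 0 ∧ max (f (x - t)) 0 = 0 := by
            rw [Set.mem_Icc, not_and_or, not_le, not_le] at ht
            constructor
            · have : f (x + t) = 0 := by
                by_contra hne
                have hm := hsupp (Function.mem_support.2 hne)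
                rcases ht with ht | ht <;> linarith [hm.1, hm.2, hx.1, hx.2]
              rw [this, max_self]
            · have : f (x - t) = 0 := by
                by_contra hne
                have hm := hsupp (Function.mem_support.2 hne)
                rcases ht with ht | ht <;> linarith [hm.1, hm.2, hx.1, hx.2]
              rw [this, max_self]
          rw [hz.1, hz.2, add_zero, mul_zero, mul_zero, Set.indicator_of_notMem ht]
      have hIi : Integrable fun t ↦ Set.indicator (Icc (-(2 * a)) (2 * a)) (fun _ ↦ (2 * C : ℝ)) t :=
        (integrable_indicator_iff measurableSet_Icc).2 (integrableOn_const (by simp))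
      have hval : ∫ t, Set.indicator (Icc (-(2 * a)) (2 * a)) (fun _ ↦ (2 * C : ℝ)) t = 2 * C * (4 * a) := by
        rw [integral_indicator measurableSet_Icc, setIntegral_const, smul_eq_mul,
          Real.volume_real_Icc_of_le (by linarith)]
        ring
      have hup : ∫ t, max (-f x) 0 * (weilArchDensity |t| * (max (f (x + t)) 0 + max (f (x - t)) 0)) ≤
          2 * C * (4 * a) := by
        rw [← hval]
        exact integral_mono_of_nonneg (Eventually.of_forall fun t ↦
          mul_nonneg (le_max_right _ _) (mul_nonneg (GroundBartaFloor.weilArchDensity_abs_nonneg t)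
            (add_nonneg (le_max_right _ _) (le_max_right _ _)))) hIi
          (Eventually.of_forall fun t ↦ (le_abs_self _).trans (hI t))
      have hlow : 0 ≤ ∫ t, max (-f x) 0 * (weilArchDensity |t| * (max (f (x + t)) 0 + max (f (x - t)) 0)) :=
        integral_nonneg fun t ↦ mul_nonneg (le_max_right _ _) (mul_nonneg (GroundBartaFloor.weilArchDensity_abs_nonneg t)
          (add_nonneg (le_max_right _ _) (le_max_right _ _)))
      have hCa : 0 ≤ 2 * C * (4 * a) := by positivity
      exact ⟨by linarith, hup⟩
    · have hfx : f x = 0 := by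
        by_contra hne; exact hx (hsupp (Function.mem_support.2 hne))
      rw [hfx, neg_zero, max_self, zero_mul, norm_zero, Set.indicator_of_notMem hx]
  have hmeas : AEStronglyMeasurable
      (fun x ↦ max (-f x) 0 *
        ∫ t, weilArchDensity |t| * (max (f (x + t)) 0 + max (f (x - t)) 0)) volume := by
    have m : Measurable (Function.uncurry fun x t ↦
        weilArchDensity |t| * (max (f (x + t)) 0 + max (f (x - t)) 0)) := by
      have m1 : Measurable fun q : ℝ × ℝ ↦ weilArchDensity |q.2| := swu_measurable_kernel.comp measurable_snd
      have m3 : Measurable fun q : ℝ × ℝ ↦ max (f (q.1 + q.2)) 0 :=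
        hp.measurable.comp (measurable_fst.add measurable_snd)
      have m4 : Measurable fun q : ℝ × ℝ ↦ max (f (q.1 - q.2)) 0 :=
        hp.measurable.comp (measurable_fst.sub measurable_snd)
      exact m1.mul (m3.add m4)
    exact hn.aestronglyMeasurable.mul m.stronglyMeasurable.integral_prod_right'.aestronglyMeasurable
  exact Integrable.mono' ((integrable_indicator_iff measurableSet_Icc).2 (integrableOn_const (by simp)))
    hmeas (Eventually.of_forall hbd)

end Fubini


end Summit.RiemannHypothesis.RiemannHypothesis.Theorems.PolarPerronFrobenius

end
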